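/-
Origin: expansion seat `prover-pub-hodgecm-mc-sinst-1-g11-0`, handover #1269 2026-08-21T03:47Z md5 c40ac7cb969c (338 l.; NEW additive leaf, ns HodgeCM.Model.ThetaAdelicSide; SLOT 2 SEAM-AUT = the slot-0 text of #1267 on the conjugated line (hypotheses hη₂c, hη₂V, hη₂W : η₂(1, ũ) = 1 for rational ũ, h₁W): adelicLinePairEquiv_adelicInr_eq_cmCenter_two, chiTwoG_rationalToFinAdelic, continuous_chiTwoG(_val), twistCharW_bigCharTwoG_eq, adelicCharTwoG_cmCenter_symm_eq_one, twistCharW_bigCharTwoG_rationalToFinAdelic, cWTwoG_eq_torusScalar_twoG_finLineTorus (carch torusScalar_twoG of ArchKTypeOfTorus), torusScalar_twoG_symm_eq_one_of (char₃_eq_one_of_rational at ratIsometry_conj), cWTwoG_∕psiTwoG_∕charTwoDictG_rationalToFinAdelic, hasRationalRestriction_charTwoDictG_one (hχinf : ∀ t, χ(♯(t,1_f))·torusScalar_twoG η₂ (u_t) = adelicCharTwoG η₂ (CMCenter (frameD V) u_t)) + _of_weight, continuous_torusScalar_twoG_val_of ∕ continuous_adelicCharTwoG_val (continuous_cmConjLineChar₀_of_signs),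 continuous_cWTwoG, continuous_twistCharW_bigCharTwoG, continuous_charTwoDictG, isLevelTrivial_charTwoDictG (UNCONDITIONAL), isAutChar_charTwoDictG + _of_weight; cert rc 0 ∕ 69 s; NAMES for audit: HodgeCM.Model.ThetaAdelicSide.charTwoDictG_rationalToFinAdelic · HodgeCM.Model.ThetaAdelicSide.isLevelTrivial_charTwoDictG · HodgeCM.Model.ThetaAdelicSide.isAutChar_charTwoDictG) (`HOME/mc/pub-hodgecm-mc-sinst-1-g11/stage70/HodgeCM/Model/AdelicThetaSlotTwoAutG.lean`, md5 c40ac7cb969c, 338 lines);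
landed by the gen-30 packager (p-g30) in gate run 71 as `HodgeCM/Model/AdelicThetaSlotTwoAutG.lean` (verbatim).
-/
/-
Copyright (c) 2026 the pub-hodgecm formalisation cell (harness21).  New file, not vendored.
Origin: session prover-pub-hodgecm-mc-sinst-1-g11-0 (unit pub-hodgecm-mc-sinst-1-g11, S-INSTANCE CONSTRUCTOR gen 11; SEAM-AUT for SLOT 2 over the
pin-agnostic G-datum: the slot-0 text of `Model/AdelicThetaSlotZeroAutG` with `dW' c.D 0`, `hGR₂ hGR₃`, `cmConjLineChar₀`, carch's `torusScalar_twoG`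
and the slot character `η₂` GENERIC), 2026-08-21.
Intended final place: `HodgeCM/Model/AdelicThetaSlotTwoAutG.lean` (NEW additive model-layer leaf; imports sinst-1 `Model/AdelicThetaSlotTwoBridgeG`
and #1260 `Model/AdelicThetaDistributionAut`; nothing imports it; drop alone).
-/
import Summits.HodgeConjecture.HodgeCM.Model.AdelicThetaSlotTwoBridgeG
import Summits.HodgeConjecture.HodgeCM.Model.AdelicThetaDistributionAut_2

set_option autoImplicit false

/-!
# The slot-2 dictionary character `χ″₂(η₂, χ) = charTwoDictG η₂ χ` is automorphic ON THE WEIGHT SET modulo one archimedean identity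

For a GENERIC slot character `η₂` (hypotheses: `hη₂c` continuity, `hη₂V : η₂(γ, 1) = 1` on `U(diag frameD V)(L⁺)`, `hη₂W : η₂(1, ũ) = 1` for
rational `ũ`): `twistCharW_bigCharTwoG_eq`, `cWTwoG_eq_torusScalar_twoG_finLineTorus`, `torusScalar_twoG_symm_eq_one_of`,
**`charTwoDictG_rationalToFinAdelic`** (`χ″₂(γ_f) = adelicCharTwoG η₂ ((t_γ,1_f) · 1_V)⁻¹ · χ(♯(t_γ,1_f)) · torusScalar_twoG η₂ (u_{t_γ})`),
**`hasRationalRestriction_charTwoDictG_one`** under `hχinf : ∀ t, χ(♯(t,1_f)) · torusScalar_twoG η₂ (u_t) = adelicCharTwoG η₂ ((t,1_f) · 1_V)`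
(= (Hw₂) on the weight set), `…_of_weight`; continuity ⇒ **`isLevelTrivial_charTwoDictG`** unconditionally; **`isAutChar_charTwoDictG`** (+ `_of_weight`).
KERNEL only: 0 records, 0 `def … : Prop`, nothing cited as a hypothesis; `#print axioms` ⊆ {propext, Classical.choice, Quot.sound}.
-/

noncomputable section

open MulAction IsDedekindDomain NumberField.mixedEmbedding
open NumberField hiding relNormOneIdeles relNormOneRat probHaarRelNormOneQuot relNormOneInfUnits relNormOneInfToIdeles
open scoped Matrix TensorProduct Classical SchwartzMap
open Literature.NumberTheory.Automorphic Literature.NumberTheory.Weil1964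
open Literature.NumberTheory.GelbartRogawski1991 Literature.NumberTheory.GelbartRogawski1991.UnitaryDualPair
open Literature.RepresentationTheory (SeesawScalar.twist SeesawScalar.twist_apply)
open Literature.Geometry.ComplexHyperbolic.BallModel (U21 x₀)
open Literature.AlgebraicGeometry.ShimuraVarieties
open HodgeCM.Adelic HodgeCM.PerL34 HodgeCM.Model.ArchSideTerm HodgeCM.Model.ThetaDistFin
open Literature.NumberTheory.Automorphic.UnitaryGroup (cmAdelicOneEquivRelNormOne)

namespace HodgeCM.Model
namespace ThetaAdelicSide

variable {L : CMField} {ι₁ : L →+* ℂ} (V : HermSpace3 L ι₁) (c : SeesawCtx L)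
  (hGR : (cmSplittingDatum (L : Type) finProdFinEquiv (frameD V) (frameD_real V) (frameD_ne V) (dW c.D) (dW_real c.D)
    (dW_ne c.D)).CompatibleSplitting)
  (hGR₂ : (cmSplittingDatum (L : Type) (e₁) (frameD V) (frameD_real V) (frameD_ne V) (lineVec (L : Type) (dW' c.D 0))
    (fun _ => dW'_real c.D 0) (fun _ => dW'_ne c.D 0)).CompatibleSplitting)
  (hGR₃ : (cmSplittingDatum (L : Type) (e₁) (frameD V) (frameD_real V) (frameD_ne V) (lineVec (L : Type) (dW' c.D 1))
    (fun _ => dW'_real c.D 1) (fun _ => dW'_ne c.D 1)).CompatibleSplitting)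
  (η₂ : CMAdelic (L : Type) (frameD V) × CMAdelicOne (L : Type) →* ℂˣ)
  (hη₂c : Continuous fun p => ((η₂ p : ℂˣ) : ℂ))
  (hη₂V : ∀ v ∈ CMRat (L : Type) (frameD V), η₂ (v, 1) = 1)
  (hη₂W : ∀ t₀ ∈ relNormOneRat (↥(maximalRealSubfield L)) L, η₂ (1, (cmAdelicOneEquivRelNormOne (L : Type)).symm t₀) = 1)
  (h₁W : (∀ j, 0 < (ι₁ (dW c.D j)).re) ∨ ∀ j, (ι₁ (dW c.D j)).re < 0)
  (χ : PontryaginDual (↥(relNormOneIdeles (↥(maximalRealSubfield L)) L) ⧸ relNormOneRat (↥(maximalRealSubfield L)) L))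

/-! ## § 1. Values on rational points -/


/-- the line identification `G₁(𝔸) ≃ U(diag frameD V)(𝔸)` of #1255 takes `1 ⊗ w` to the CENTRE element `(det w) · 1_V` (line `⟨a₂⟩`). -/
theorem adelicLinePairEquiv_adelicInr_eq_cmCenter_two (w : CMAdelic (L : Type) (lineVec (L : Type) (dW' c.D 0))) :
    LinePair.adelicLinePairEquiv (↥(maximalRealSubfield L)) (L : Type) (IsCMField.complexConj L) 3 (Matrix.diagonal (frameD V))
        (Matrix.diagonal (lineVec (L : Type) (dW' c.D 0))) (lineVec_dW'_zero_ne c)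
        (UnitaryGroup.adelicInr (↥(maximalRealSubfield L)) (L : Type) (IsCMField.complexConj L) 3 1 (Matrix.diagonal (frameD V))
          (Matrix.diagonal (lineVec (L : Type) (dW' c.D 0))) w) =
      CMCenter (L : Type) (frameD V) (cmAdelicDet (L : Type) (lineVec (L : Type) (dW' c.D 0)) (fun _ => dW'_ne c.D 0) w) := by
  apply Subtype.ext
  apply Units.ext
  rw [LinePair.coe_adelicLinePairEquiv_adelicInr, UnitaryGroup.coe_adelicCenter, coe_cmAdelicDet, Matrix.GeneralLinearGroup.val_det_apply,
    Matrix.det_unique]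

/-- `chiTwoG χ (γ_f) = χ(♯(t_γ, 1_f))`. -/
theorem chiTwoG_rationalToFinAdelic
    (γ : ↥(UnitaryGroup.rational (↥(maximalRealSubfield L)) (L : Type) (IsCMField.complexConj L) 1
      (Matrix.diagonal (lineVec (L : Type) (dW' c.D 0))))) :
    chiTwoG c χ (UnitaryGroup.rationalToFinAdelic (↥(maximalRealSubfield L)) (L : Type) (IsCMField.complexConj L) 1
        (Matrix.diagonal (lineVec (L : Type) (dW' c.D 0))) γ) =
      Circle.toUnits (χ (QuotientGroup.mk
        (relNormOneInfToIdeles (↥(maximalRealSubfield L)) L (ratInfPart (L : Type) (dW' c.D 0) (dW'_ne c.D 0) γ)))) := by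
  rw [chiTwoG]
  simp only [MonoidHom.coe_comp, Function.comp_apply, QuotientGroup.mk'_apply, invMonoidHom_apply,
    mk_finLineTorusIdeles_rationalToFinAdelic, map_inv, inv_inv, MonoidHom.coe_coe]

/-- the coinvariant character of slot 2 has continuous values. -/
theorem continuous_chiTwoG_val : Continuous fun u : UfTwo c.D => ((chiTwoG c χ u : ℂˣ) : ℂ) := by
  have hf : Continuous (finLineTorusIdeles (L : Type) (dW' c.D 0) (dW'_ne c.D 0)) :=
    (continuous_cmAdelicOneEquivRelNormOne (L : Type)).comp
      ((continuous_cmAdelicDet (L : Type) (lineVec (L : Type) (dW' c.D 0)) fun _ => dW'_ne c.D 0).comp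
        (UnitaryGroup.continuous_finAdelicToAdelic _ _ _ _ _))
  show Continuous fun u : UfTwo c.D =>
    ((((χ : ↥(relNormOneIdeles (↥(maximalRealSubfield L)) L) ⧸ relNormOneRat (↥(maximalRealSubfield L)) L →* Circle)
      (QuotientGroup.mk (finLineTorusIdeles (L : Type) (dW' c.D 0) (dW'_ne c.D 0) u)))⁻¹ : Circle) : ℂ)
  exact continuous_subtype_val.comp (((map_continuous χ).comp (QuotientGroup.continuous_mk.comp hf)).inv)

/-- the coinvariant character of slot 2 is continuous (into `ℂˣ`). -/
theorem continuous_chiTwoG : Continuous (chiTwoG c χ) :=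
  (chiTwoG c χ).continuous_of_continuous_units_val (continuous_chiTwoG_val c χ)

/-- **`twistCharW ĉ₂(η₂) u = adelicCharTwoG η₂ ((det (1_∞, u)) · 1_V)`**. -/
theorem twistCharW_bigCharTwoG_eq (u : UfTwo c.D) :
    HodgeCM.WeilCoinv.twistCharW (↥(maximalRealSubfield L)) (L : Type) (IsCMField.complexConj L) 3 1
        (Matrix.diagonal (frameD V)) (splitLineTwoG V c hGR₂).JW (bigCharTwoG V c hGR hGR₂ hGR₃ η₂) u =
      adelicCharTwoG V c hGR hGR₂ hGR₃ η₂ (CMCenter (L : Type) (frameD V) (finLineTorus (L : Type) (dW' c.D 0) (dW'_ne c.D 0) u)) := by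
  show HodgeCM.WeilCoinv.twistCharW (↥(maximalRealSubfield L)) (L : Type) (IsCMField.complexConj L) 3 1
      (Matrix.diagonal (frameD V)) (Matrix.diagonal (lineVec (L : Type) (dW' c.D 0))) (bigCharTwoG V c hGR hGR₂ hGR₃ η₂) u = _
  rw [bigCharTwoG, LinePair.twistCharW_bigCharOfV_apply, adelicLinePairEquiv_adelicInr_eq_cmCenter_two, finLineTorus_apply]

include hη₂V in
/-- `adelicCharTwoG η₂` is trivial on the RATIONAL centre. -/
theorem adelicCharTwoG_cmCenter_symm_eq_one {t₀ : ↥(relNormOneIdeles (↥(maximalRealSubfield L)) L)}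
    (ht₀ : t₀ ∈ relNormOneRat (↥(maximalRealSubfield L)) L) :
    adelicCharTwoG V c hGR hGR₂ hGR₃ η₂ (CMCenter (L : Type) (frameD V) ((cmAdelicOneEquivRelNormOne (L : Type)).symm t₀)) = 1 :=
  adelicCharTwoG_eq_one_of_rat V c hGR hGR₂ hGR₃ η₂ hη₂V
    (UnitaryGroup.cm_adelicCenter_symm_mem_range_toAdelic (L : Type) 3 (Matrix.diagonal (frameD V)) t₀ ht₀)

include hη₂V in
/-- **`twistCharW ĉ₂(η₂) (γ_f) = adelicCharTwoG η₂ ((t_γ, 1_f) · 1_V)⁻¹`** on a rational point. -/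
theorem twistCharW_bigCharTwoG_rationalToFinAdelic
    (γ : ↥(UnitaryGroup.rational (↥(maximalRealSubfield L)) (L : Type) (IsCMField.complexConj L) 1
      (Matrix.diagonal (lineVec (L : Type) (dW' c.D 0))))) :
    HodgeCM.WeilCoinv.twistCharW (↥(maximalRealSubfield L)) (L : Type) (IsCMField.complexConj L) 3 1
        (Matrix.diagonal (frameD V)) (splitLineTwoG V c hGR₂).JW (bigCharTwoG V c hGR hGR₂ hGR₃ η₂)
        (UnitaryGroup.rationalToFinAdelic (↥(maximalRealSubfield L)) (L : Type) (IsCMField.complexConj L) 1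
          (Matrix.diagonal (lineVec (L : Type) (dW' c.D 0))) γ) =
      (adelicCharTwoG V c hGR hGR₂ hGR₃ η₂ (CMCenter (L : Type) (frameD V) (ratInfOne (L : Type) (dW' c.D 0) (dW'_ne c.D 0) γ)))⁻¹ := by
  rw [twistCharW_bigCharTwoG_eq, finLineTorus_rationalToFinAdelic, map_mul, map_inv, map_mul, map_inv,
    adelicCharTwoG_cmCenter_symm_eq_one V c hGR hGR₂ hGR₃ η₂ hη₂V (ratDetIdele_mem_relNormOneRat (L : Type) (dW' c.D 0) (dW'_ne c.D 0) γ),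
    mul_one]
  rfl

/-- `cWTwoG η₂ = torusScalar_twoG η₂ ∘ finLineTorus`. -/
theorem cWTwoG_eq_torusScalar_twoG_finLineTorus (u : UfTwo c.D) :
    cWTwoG V c hGR hGR₂ hGR₃ η₂ u =
      torusScalar_twoG V c.D hGR hGR₂ hGR₃ η₂ (finLineTorus (L : Type) (dW' c.D 0) (dW'_ne c.D 0) u) := by
  rw [cWTwoG_apply, finCharTwo_apply, finPairDTwo_apply, map_one, map_one, torusScalar_two_applyG, cmCenter_finLineTorus]
  rfl

include hη₂W in
/-- the torus scalar of line 2 at `η₂` is trivial on RATIONAL points (`hη₂W` + [Weil1964, Thm 6] `char₄_eq_one_of_rational`). -/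
theorem torusScalar_twoG_symm_eq_one_of {t₀ : ↥(relNormOneIdeles (↥(maximalRealSubfield L)) L)}
    (ht₀ : t₀ ∈ relNormOneRat (↥(maximalRealSubfield L)) L) :
    torusScalar_twoG V c.D hGR hGR₂ hGR₃ η₂ ((cmAdelicOneEquivRelNormOne (L : Type)).symm t₀) = 1 := by
  obtain ⟨γ₀, hγ₀⟩ := UnitaryGroup.cm_adelicCenter_symm_mem_range_toAdelic (L : Type) 1
    (Matrix.diagonal (lineVec (L : Type) (dW' c.D 0))) t₀ ht₀
  have hχ1 : cmConjLineChar₀ (L : Type) finProdFinEquiv e₁ (frameD V) (frameD_real V) (frameD_ne V) (dW c.D) (dW_real c.D) (dW_ne c.D)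
        (dW' c.D) (dW'_real c.D) (dW'_ne c.D) c.D.isoGL (isoGL_hg₀ c.D) hGR hGR₂ hGR₃ (1, CMCenter (L : Type) (lineVec (L : Type) (dW' c.D 0)) ((cmAdelicOneEquivRelNormOne (L : Type)).symm t₀)) = 1 := by
    rw [cmConjLineChar₀]
    simp only [MonoidHom.mul_apply, MonoidHom.coe_comp, Function.comp_apply, MonoidHom.coe_fst, MonoidHom.coe_snd, map_one, one_mul]
    apply char₃_eq_one_of_rational
    · exact ratIsometry_conj (L : Type) (dW c.D) (dW' c.D) c.D.isoGL (isoGL_hg₀ c.D)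
    · exact ⟨γ₀, hγ₀⟩
  rw [torusScalar_two_applyG, hη₂W t₀ ht₀, hχ1, mul_one]

include hη₂W in
/-- `cWTwoG η₂ (γ_f) = torusScalar_twoG η₂ (u_{t_γ})⁻¹`. -/
theorem cWTwoG_rationalToFinAdelic
    (γ : ↥(UnitaryGroup.rational (↥(maximalRealSubfield L)) (L : Type) (IsCMField.complexConj L) 1
      (Matrix.diagonal (lineVec (L : Type) (dW' c.D 0))))) :
    cWTwoG V c hGR hGR₂ hGR₃ η₂ (UnitaryGroup.rationalToFinAdelic (↥(maximalRealSubfield L)) (L : Type) (IsCMField.complexConj L) 1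
        (Matrix.diagonal (lineVec (L : Type) (dW' c.D 0))) γ) =
      (torusScalar_twoG V c.D hGR hGR₂ hGR₃ η₂ (ratInfOne (L : Type) (dW' c.D 0) (dW'_ne c.D 0) γ))⁻¹ := by
  rw [cWTwoG_eq_torusScalar_twoG_finLineTorus, finLineTorus_rationalToFinAdelic, map_mul, map_inv,
    torusScalar_twoG_symm_eq_one_of V c hGR hGR₂ hGR₃ η₂ hη₂W (ratDetIdele_mem_relNormOneRat (L : Type) (dW' c.D 0) (dW'_ne c.D 0) γ),
    mul_one]
  rfl

include hη₂W in
/-- `ψ₂(η₂, χ)(γ_f) = χ(♯(t_γ, 1_f)) · torusScalar_twoG η₂ (u_{t_γ})`. -/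
theorem psiTwoG_rationalToFinAdelic
    (γ : ↥(UnitaryGroup.rational (↥(maximalRealSubfield L)) (L : Type) (IsCMField.complexConj L) 1
      (Matrix.diagonal (lineVec (L : Type) (dW' c.D 0))))) :
    psiTwoG V c hGR hGR₂ hGR₃ η₂ χ (UnitaryGroup.rationalToFinAdelic (↥(maximalRealSubfield L)) (L : Type) (IsCMField.complexConj L) 1
        (Matrix.diagonal (lineVec (L : Type) (dW' c.D 0))) γ) =
      Circle.toUnits (χ (QuotientGroup.mk
          (relNormOneInfToIdeles (↥(maximalRealSubfield L)) L (ratInfPart (L : Type) (dW' c.D 0) (dW'_ne c.D 0) γ)))) *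
        torusScalar_twoG V c.D hGR hGR₂ hGR₃ η₂ (ratInfOne (L : Type) (dW' c.D 0) (dW'_ne c.D 0) γ) := by
  rw [psiTwoG, MonoidHom.mul_apply, MonoidHom.inv_apply, chiTwoG_rationalToFinAdelic, cWTwoG_rationalToFinAdelic V c hGR hGR₂ hGR₃ η₂ hη₂W,
    inv_inv]

include hη₂V hη₂W in
/-- **`χ″₂(γ_f) = adelicCharTwoG η₂ ((t_γ,1_f) · 1_V)⁻¹ · (χ(♯(t_γ, 1_f)) · torusScalar_twoG η₂ (u_{t_γ}))`** — an ARCHIMEDEAN quantity. -/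
theorem charTwoDictG_rationalToFinAdelic
    (γ : ↥(UnitaryGroup.rational (↥(maximalRealSubfield L)) (L : Type) (IsCMField.complexConj L) 1
      (Matrix.diagonal (lineVec (L : Type) (dW' c.D 0))))) :
    charTwoDictG V c hGR hGR₂ hGR₃ η₂ χ (UnitaryGroup.rationalToFinAdelic (↥(maximalRealSubfield L)) (L : Type)
        (IsCMField.complexConj L) 1 (Matrix.diagonal (lineVec (L : Type) (dW' c.D 0))) γ) =
      (adelicCharTwoG V c hGR hGR₂ hGR₃ η₂ (CMCenter (L : Type) (frameD V) (ratInfOne (L : Type) (dW' c.D 0) (dW'_ne c.D 0) γ)))⁻¹ *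
        (Circle.toUnits (χ (QuotientGroup.mk
            (relNormOneInfToIdeles (↥(maximalRealSubfield L)) L (ratInfPart (L : Type) (dW' c.D 0) (dW'_ne c.D 0) γ)))) *
          torusScalar_twoG V c.D hGR hGR₂ hGR₃ η₂ (ratInfOne (L : Type) (dW' c.D 0) (dW'_ne c.D 0) γ)) := by
  rw [charTwoDictG, MonoidHom.mul_apply, twistCharW_bigCharTwoG_rationalToFinAdelic V c hGR hGR₂ hGR₃ η₂ hη₂V]
  exact congrArg _ (psiTwoG_rationalToFinAdelic V c hGR hGR₂ hGR₃ η₂ hη₂W χ γ)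

/-! ## § 2. Rational triviality from ONE archimedean identity -/

include hη₂V hη₂W in
/-- **`χ″₂` IS TRIVIAL ON `U(⟨a₂⟩)(L⁺)`** as soon as `χ(♯(t,1_f)) · torusScalar_twoG η₂ (u_t) = adelicCharTwoG η₂ ((t,1_f) · 1_V)` on the
archimedean torus. -/
theorem hasRationalRestriction_charTwoDictG_one
    (hχinf : ∀ t : ↥(relNormOneInfUnits (↥(maximalRealSubfield L)) L),
      ((χ (QuotientGroup.mk (relNormOneInfToIdeles (↥(maximalRealSubfield L)) L t)) : Circle) : ℂ) *
          ((torusScalar_twoG V c.D hGR hGR₂ hGR₃ η₂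
            ((cmAdelicOneEquivRelNormOne (L : Type)).symm (relNormOneInfToIdeles (↥(maximalRealSubfield L)) L t)) : ℂˣ) : ℂ) =
        ((adelicCharTwoG V c hGR hGR₂ hGR₃ η₂ (CMCenter (L : Type) (frameD V)
            ((cmAdelicOneEquivRelNormOne (L : Type)).symm (relNormOneInfToIdeles (↥(maximalRealSubfield L)) L t))) : ℂˣ) : ℂ)) :
    (splitLineTwoTwistedG V c hGR hGR₂ hGR₃ η₂ hη₂V).HasRationalRestriction (charTwoDictG V c hGR hGR₂ hGR₃ η₂ χ) 1 := by
  rw [SplitLine.hasRationalRestriction_iff]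
  intro γ
  have h := charTwoDictG_rationalToFinAdelic V c hGR hGR₂ hGR₃ η₂ hη₂V hη₂W χ γ
  have hne : adelicCharTwoG V c hGR hGR₂ hGR₃ η₂ (CMCenter (L : Type) (frameD V) (ratInfOne (L : Type) (dW' c.D 0) (dW'_ne c.D 0) γ)) *
      1 = adelicCharTwoG V c hGR hGR₂ hGR₃ η₂ (CMCenter (L : Type) (frameD V) (ratInfOne (L : Type) (dW' c.D 0) (dW'_ne c.D 0) γ)) *
        ((adelicCharTwoG V c hGR hGR₂ hGR₃ η₂ (CMCenter (L : Type) (frameD V) (ratInfOne (L : Type) (dW' c.D 0) (dW'_ne c.D 0) γ)))⁻¹ *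
          (Circle.toUnits (χ (QuotientGroup.mk
              (relNormOneInfToIdeles (↥(maximalRealSubfield L)) L (ratInfPart (L : Type) (dW' c.D 0) (dW'_ne c.D 0) γ)))) *
            torusScalar_twoG V c.D hGR hGR₂ hGR₃ η₂ (ratInfOne (L : Type) (dW' c.D 0) (dW'_ne c.D 0) γ))) := by
    rw [mul_one, mul_inv_cancel_left]
    apply Units.ext
    rw [Units.val_mul]
    exact (hχinf _).symm
  rw [MonoidHom.one_apply]
  exact h.trans (mul_left_cancel hne).symm

include hη₂V hη₂W in
/-- the same from the WEIGHT identity and (Hw₂) `w t · adelicCharTwoG η₂ ((t,1_f) · 1_V) = torusScalar_twoG η₂ (u_t)`. -/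
theorem hasRationalRestriction_charTwoDictG_one_of_weight (w : ↥(relNormOneInfUnits (↥(maximalRealSubfield L)) L) → ℂ)
    (hχw : ∀ t : ↥(relNormOneInfUnits (↥(maximalRealSubfield L)) L),
      ((χ (QuotientGroup.mk (relNormOneInfToIdeles (↥(maximalRealSubfield L)) L t)) : Circle) : ℂ) * w t = 1)
    (hw : ∀ t : ↥(relNormOneInfUnits (↥(maximalRealSubfield L)) L),
      w t * ((adelicCharTwoG V c hGR hGR₂ hGR₃ η₂ (CMCenter (L : Type) (frameD V)
            ((cmAdelicOneEquivRelNormOne (L : Type)).symm (relNormOneInfToIdeles (↥(maximalRealSubfield L)) L t))) : ℂˣ) : ℂ) =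
        ((torusScalar_twoG V c.D hGR hGR₂ hGR₃ η₂
            ((cmAdelicOneEquivRelNormOne (L : Type)).symm (relNormOneInfToIdeles (↥(maximalRealSubfield L)) L t)) : ℂˣ) : ℂ)) :
    (splitLineTwoTwistedG V c hGR hGR₂ hGR₃ η₂ hη₂V).HasRationalRestriction (charTwoDictG V c hGR hGR₂ hGR₃ η₂ χ) 1 := by
  refine hasRationalRestriction_charTwoDictG_one V c hGR hGR₂ hGR₃ η₂ hη₂V hη₂W χ fun t => ?_
  rw [← hw t, ← mul_assoc, hχw t, one_mul]

/-! ## § 3. Level triviality (continuity) and `IsAutChar` -/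

include hη₂c h₁W in
/-- carch's torus scalar of line 2 at `η₂` has continuous values. -/
theorem continuous_torusScalar_twoG_val_of :
    Continuous fun u : CMAdelicOne (L : Type) => ((torusScalar_twoG V c.D hGR hGR₂ hGR₃ η₂ u : ℂˣ) : ℂ) := by
  have h1 : Continuous fun u : CMAdelicOne (L : Type) => ((η₂ (1, u) : ℂˣ) : ℂ) := hη₂c.comp (continuous_const.prodMk continuous_id)
  have h2 : Continuous fun u : CMAdelicOne (L : Type) =>
      ((cmConjLineChar₀ (L : Type) finProdFinEquiv e₁ (frameD V) (frameD_real V) (frameD_ne V) (dW c.D) (dW_real c.D) (dW_ne c.D)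
        (dW' c.D) (dW'_real c.D) (dW'_ne c.D) c.D.isoGL (isoGL_hg₀ c.D) hGR hGR₂ hGR₃ (1, CMCenter (L : Type) (lineVec (L : Type) (dW' c.D 0)) u) : ℂˣ) : ℂ) :=
    (continuous_cmConjLineChar₀_of_signs (L : Type) finProdFinEquiv e₁ (frameD V) (frameD_real V) (frameD_ne V) (dW c.D) (dW_real c.D)
        (dW_ne c.D) hGR (dW' c.D) (dW'_real c.D) (dW'_ne c.D) c.D.isoGL (isoGL_hg₀ c.D) hGR₂ hGR₃ ι₁ (frameD_sign_ι₁' V) h₁W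
        (frameD_sign_of_ne V)).comp
      (continuous_const.prodMk (continuous_adelicCenter _ _ _ _ _))
  simp only [torusScalar_two_applyG, Units.val_mul]
  exact h1.mul h2

include hη₂c h₁W in
/-- the adelic `V`-character `adelicCharTwoG η₂` has continuous values. -/
theorem continuous_adelicCharTwoG_val :
    Continuous fun v : CMAdelic (L : Type) (frameD V) => ((adelicCharTwoG V c hGR hGR₂ hGR₃ η₂ v : ℂˣ) : ℂ) := by
  have h1 : Continuous fun v : CMAdelic (L : Type) (frameD V) => ((η₂ (v, 1) : ℂˣ) : ℂ) := hη₂c.comp (continuous_id.prodMk continuous_const)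
  have h2 : Continuous fun v : CMAdelic (L : Type) (frameD V) =>
      ((cmConjLineChar₀ (L : Type) finProdFinEquiv e₁ (frameD V) (frameD_real V) (frameD_ne V) (dW c.D) (dW_real c.D) (dW_ne c.D)
        (dW' c.D) (dW'_real c.D) (dW'_ne c.D) c.D.isoGL (isoGL_hg₀ c.D) hGR hGR₂ hGR₃ (v, 1) : ℂˣ) : ℂ) :=
    (continuous_cmConjLineChar₀_of_signs (L : Type) finProdFinEquiv e₁ (frameD V) (frameD_real V) (frameD_ne V) (dW c.D) (dW_real c.D)
        (dW_ne c.D) hGR (dW' c.D) (dW'_real c.D) (dW'_ne c.D) c.D.isoGL (isoGL_hg₀ c.D) hGR₂ hGR₃ ι₁ (frameD_sign_ι₁' V) h₁W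
        (frameD_sign_of_ne V)).comp
      (continuous_id.prodMk continuous_const)
  simp only [adelicCharTwoG_apply, Units.val_mul]
  exact h1.mul h2

include hη₂c h₁W in
/-- `cWTwoG η₂` is continuous (into `ℂˣ`). -/
theorem continuous_cWTwoG : Continuous (cWTwoG V c hGR hGR₂ hGR₃ η₂) := by
  apply (cWTwoG V c hGR hGR₂ hGR₃ η₂).continuous_of_continuous_units_val
  have hf : Continuous (finLineTorus (L : Type) (dW' c.D 0) (dW'_ne c.D 0)) :=
    (continuous_cmAdelicDet (L : Type) (lineVec (L : Type) (dW' c.D 0)) fun _ => dW'_ne c.D 0).comp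
      (UnitaryGroup.continuous_finAdelicToAdelic _ _ _ _ _)
  simp only [cWTwoG_eq_torusScalar_twoG_finLineTorus]
  exact (continuous_torusScalar_twoG_val_of V c hGR hGR₂ hGR₃ η₂ hη₂c h₁W).comp hf

include hη₂c h₁W in
/-- the `W`-part of `ĉ₂(η₂)` is continuous (into `ℂˣ`). -/
theorem continuous_twistCharW_bigCharTwoG :
    Continuous (HodgeCM.WeilCoinv.twistCharW (↥(maximalRealSubfield L)) (L : Type) (IsCMField.complexConj L) 3 1
      (Matrix.diagonal (frameD V)) (splitLineTwoG V c hGR₂).JW (bigCharTwoG V c hGR hGR₂ hGR₃ η₂)) := by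
  apply MonoidHom.continuous_of_continuous_units_val
  have hf : Continuous (finLineTorus (L : Type) (dW' c.D 0) (dW'_ne c.D 0)) :=
    (continuous_cmAdelicDet (L : Type) (lineVec (L : Type) (dW' c.D 0)) fun _ => dW'_ne c.D 0).comp
      (UnitaryGroup.continuous_finAdelicToAdelic _ _ _ _ _)
  simp only [twistCharW_bigCharTwoG_eq]
  exact (continuous_adelicCharTwoG_val V c hGR hGR₂ hGR₃ η₂ hη₂c h₁W).comp ((continuous_adelicCenter _ _ _ _ _).comp hf)

include hη₂c h₁W in
/-- `χ″₂` is continuous (into `ℂˣ`). -/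
theorem continuous_charTwoDictG : Continuous (charTwoDictG V c hGR hGR₂ hGR₃ η₂ χ) := by
  show Continuous fun u =>
    HodgeCM.WeilCoinv.twistCharW (↥(maximalRealSubfield L)) (L : Type) (IsCMField.complexConj L) 3 1
        (Matrix.diagonal (frameD V)) (splitLineTwoG V c hGR₂).JW (bigCharTwoG V c hGR hGR₂ hGR₃ η₂) u *
      (chiTwoG c χ u * (cWTwoG V c hGR hGR₂ hGR₃ η₂ u)⁻¹)
  exact (continuous_twistCharW_bigCharTwoG V c hGR hGR₂ hGR₃ η₂ hη₂c h₁W).mul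
    ((continuous_chiTwoG c χ).mul (continuous_cWTwoG V c hGR hGR₂ hGR₃ η₂ hη₂c h₁W).inv)

include hη₂c h₁W in
/-- **`χ″₂` IS LEVEL-TRIVIAL** on the twisted slot-2 record — unconditionally. -/
theorem isLevelTrivial_charTwoDictG :
    (splitLineTwoTwistedG V c hGR hGR₂ hGR₃ η₂ hη₂V).IsLevelTrivial (charTwoDictG V c hGR hGR₂ hGR₃ η₂ χ) := by
  obtain ⟨n₀, hn₀, h⟩ := UnitaryGroup.exists_nat_forall_dvd_finCongruenceLevel_le_ker (charTwoDictG V c hGR hGR₂ hGR₃ η₂ χ)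
    (continuous_charTwoDictG V c hGR hGR₂ hGR₃ η₂ hη₂c h₁W χ).continuousAt
  exact ⟨n₀, hn₀, fun k hk => h n₀ hn₀ (dvd_refl _) k hk⟩

include hη₂c hη₂W h₁W in
/-- **`χ″₂ = charTwoDictG η₂ χ` IS A `GoodChar` OF THE TWISTED SLOT-2 RECORD** (`IsAutChar`) under the ONE archimedean identity — binder-2's
socket hypothesis `hχ` for slot 2, at every pin. -/
theorem isAutChar_charTwoDictG
    (hχinf : ∀ t : ↥(relNormOneInfUnits (↥(maximalRealSubfield L)) L),
      ((χ (QuotientGroup.mk (relNormOneInfToIdeles (↥(maximalRealSubfield L)) L t)) : Circle) : ℂ) *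
          ((torusScalar_twoG V c.D hGR hGR₂ hGR₃ η₂
            ((cmAdelicOneEquivRelNormOne (L : Type)).symm (relNormOneInfToIdeles (↥(maximalRealSubfield L)) L t)) : ℂˣ) : ℂ) =
        ((adelicCharTwoG V c hGR hGR₂ hGR₃ η₂ (CMCenter (L : Type) (frameD V)
            ((cmAdelicOneEquivRelNormOne (L : Type)).symm (relNormOneInfToIdeles (↥(maximalRealSubfield L)) L t))) : ℂˣ) : ℂ)) :
    (splitLineTwoTwistedG V c hGR hGR₂ hGR₃ η₂ hη₂V).IsAutChar (charTwoDictG V c hGR hGR₂ hGR₃ η₂ χ) :=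
  ⟨isLevelTrivial_charTwoDictG V c hGR hGR₂ hGR₃ η₂ hη₂c hη₂V h₁W χ,
    hasRationalRestriction_charTwoDictG_one V c hGR hGR₂ hGR₃ η₂ hη₂V hη₂W χ hχinf⟩

include hη₂c hη₂W h₁W in
/-- the same from the WEIGHT identity and (Hw₂). -/
theorem isAutChar_charTwoDictG_of_weight (w : ↥(relNormOneInfUnits (↥(maximalRealSubfield L)) L) → ℂ)
    (hχw : ∀ t : ↥(relNormOneInfUnits (↥(maximalRealSubfield L)) L),
      ((χ (QuotientGroup.mk (relNormOneInfToIdeles (↥(maximalRealSubfield L)) L t)) : Circle) : ℂ) * w t = 1)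
    (hw : ∀ t : ↥(relNormOneInfUnits (↥(maximalRealSubfield L)) L),
      w t * ((adelicCharTwoG V c hGR hGR₂ hGR₃ η₂ (CMCenter (L : Type) (frameD V)
            ((cmAdelicOneEquivRelNormOne (L : Type)).symm (relNormOneInfToIdeles (↥(maximalRealSubfield L)) L t))) : ℂˣ) : ℂ) =
        ((torusScalar_twoG V c.D hGR hGR₂ hGR₃ η₂
            ((cmAdelicOneEquivRelNormOne (L : Type)).symm (relNormOneInfToIdeles (↥(maximalRealSubfield L)) L t)) : ℂˣ) : ℂ)) :
    (splitLineTwoTwistedG V c hGR hGR₂ hGR₃ η₂ hη₂V).IsAutChar (charTwoDictG V c hGR hGR₂ hGR₃ η₂ χ) :=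
  ⟨isLevelTrivial_charTwoDictG V c hGR hGR₂ hGR₃ η₂ hη₂c hη₂V h₁W χ,
    hasRationalRestriction_charTwoDictG_one_of_weight V c hGR hGR₂ hGR₃ η₂ hη₂V hη₂W χ w hχw hw⟩

end ThetaAdelicSide
end HodgeCM.Model

end
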